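import Mathlib
import Literature.MathematicalPhysics.QuantumFieldTheory.Balaban1983to89.B5Hk103ScalarZd

/-!
# Bałaban [B5] p. 29 / (1.103) p. 34 — UNIQUENESS of the scalar operator `H` on the whole lattice `ℤ^d`
# and its independence of the auxiliary parameter `a`

**Sources (verbatim; the quotations LOCATE the object — nothing printed is used as a hypothesis).**

* [B5] T. Bałaban, *Propagators and renormalization transformations for lattice gauge theories. I*, Commun. Math.
  Phys. **95** (1984) 17–40 [`Balaban1984PropagatorsI`], p. 29 [PDF 13] (render
  `1984-cmp95-propagators-rt-I-p013-x2.png`, read as an image by this unit): «Using (1.60), or better (1.63), we can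
  verify all the properties of H_kB: Q_kH_kB = B, R∂*H_kB = 0, H_kB is a minimum of ½⟨∂A, ∂A⟩ on the hyperplane
  {A : Q_kA = B, R∂*A = 0}, which means that ⟨∂A′, ∂H_kB⟩ = 0 on the subspace {A′ : Q_kA′ = 0, R∂*A′ = 0}.»; and
  p. 34 [PDF 18] (render `1984-cmp95-propagators-rt-I-p018-x2.png`, read as an image by this unit): «A = −GQ*ω,
  (1.98) … The condition QA = B gives the equation −QGQ*ω = B, −ω = (QGQ*)⁻¹B, (1.102) so finally we get the
  representation H_kB = GQ*(QGQ*)⁻¹B. (1.103) This representation allows us to reduce a proof of properties of H_k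
  to the corresponding properties of G.»  In the print `H_k` is CHARACTERISED by the `a`-free variational problem
  quoted from p. 29 and REPRESENTED through the auxiliary operator `G` built with the parameter `a` (the metric `Δ_a`
  of (1.104), same page); the representation (1.103) therefore denotes one and the same operator for every auxiliary
  `a > 0` — in the scalar whole-lattice analogue this is the content of `kerH_eq_kerH` below.
* [B6] T. Bałaban, *Propagators and renormalization transformations for lattice gauge theories. II*, Commun. Math.
  Phys. **96** (1984) 223–250 [`Balaban1984PropagatorsII`], p. 236 (2.74)–(2.76) (the whole-lattice operators
  `G'_j = (Δ^{L^{−j}} + a_jQ'_j*Q'_j)^{−1}`; kernel-certified in the scalar case by `B6QGQLower276`, `B6QGQDecay237`).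

**What this module proves (KERNEL, hypothesis-free; scalar case `U = 1`; site coordinates on `ℤ^d`, mesh
`η = 1/(n+1)` with `n : ℕ` ARBITRARY).**  It closes item (v) of the HONEST SCOPE of `B5Hk103ScalarZd` («global
uniqueness and `a`-independence of `H` are not claimed»):

* `eq_zero_of_weakEL` (a LIOUVILLE-type uniqueness theorem for the constrained variational problem of p. 29, scalar,
  on `ℤ^d`): a square-summable fine field `D : ℤ^d → ℝ` whose block sums all vanish (`Q'D = 0`) and which satisfies
  the weak Euler–Lagrange equation `⟨Δ^η A', D⟩ = 0` against every finitely supported block-mean-zero test field `A'`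
  is identically zero.  Mechanism: the Euler–Lagrange equation tested on two-point fields `δ_p − δ_q` inside one
  block makes `ΔD` constant on blocks (`lapRow_eq_of_blk_eq`); pairing with `D` and using `Q'D = 0` block by block
  gives `⟨ΔD, D⟩ = 0` (`tsum_lapRow_mul_eq_zero`); the `ℓ²` summation by parts `⟨ΔD, D⟩ = Σ_μ ‖∇_μ D‖²`
  (`tsum_lapRow_mul_self`) forces `D` to be invariant under the unit shifts, and a shift-invariant square-summable
  field vanishes (`d ≥ 1`: square-summable sequences tend to zero along the injective orbit `k ↦ p + k e_μ`;
  `d = 0`: the single block condition).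
* `kerH_unique`: ANY kernel `K(p,y)` on `ℤ^d × ℤ^d` with square-summable columns, `Q'K = I` (block sums
  `(n+1)^d δ_{y''y}`) and the weak Euler–Lagrange equation in `p` for every `y` coincides with the kernel
  `kerH n a = G'Q'*(Q'G'Q'*)⁻¹` of `B5Hk103ScalarZd` — for every `a > 0`.
* `kerH_eq_kerH`: consequently `kerH n a = kerH n a'` for all `a, a' > 0` — the scalar whole-lattice counterpart of
  the print's `a`-free variational characterisation of `H_k` (p. 29) versus its `a`-dependent representation (1.103).

DICTIONARY (as in `B5Hk103ScalarZd`, honest): fine field `f : ℤ^d → ℝ` in SITE coordinates of the `η`-lattice;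
`Q'f(y) = (n+1)^{−d}Σ_{p∈B(y)}f(p)`; the unit-lattice minus-Laplacian row `lapRow D p = Σ_μ (2D(p) − D(p+e_μ) −
D(p−e_μ)) = Σ_r lapKer p r D(r)` (`B5Hk103ScalarZd.tsum_lapKer_mul`); `Δ^η = (n+1)²·lapKer` entrywise; the weak
Euler–Lagrange equation is stated EXACTLY in the form certified for `kerH` by `B5Hk103ScalarZd.weakEL_kerH`.

HONEST SCOPE.  (i) SCALAR analogue only (no gauge condition `R∂*A = 0`, plain block averaging `Q'`), as in
`B5Hk103ScalarZd`; (ii) WHOLE lattice `ℤ^d`, not the torus `T_η`; (iii) uniqueness is proved in the class of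
square-summable columns (the class in which `B5Hk103ScalarZd` constructs `kerH`, cf. its `abs_kerH_le`); no
statement about non-`ℓ²` solutions (e.g. affine fields, which satisfy the Euler–Lagrange equation but not `Q'D = 0`
square-summably) is made or needed.

ABSOLUTE-RULE CENSUS: every theorem below is proved outright from the tree module `B5Hk103ScalarZd` (and through it
`B6QGQDecay237`, `B6QGQLower276`) and Mathlib (sorry-free; axioms `propext`, `Classical.choice`, `Quot.sound` only);
no quoted statement is used as a hypothesis.  Unit `b2b-balaban-pv23-g7` (surge node prover #23, gen 7; journal
claim B5-103-HK-SCALAR-ZD-UNIQ); value = kernel discharge (uniqueness half of WALL v2.2 §9 row «B5 (1.99)–(1.103)»,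
scalar), NOT summit progress.
-/

namespace Literature.MathematicalPhysics.QuantumFieldTheory.Balaban1983to89.B5Hk103Unique

open Finset Real Filter Topology
open B6QGQLower276 B6QGQDecay237 B5Hk103ScalarZd

noncomputable section

variable {d : ℕ}

/-! ## §1  The objects: Laplacian row, block-mean-zero fields, the weak Euler–Lagrange equation [folklore dictionary] -/

/-- `(−Δ^1 D)(p) = Σ_μ (2D(p) − D(p+e_μ) − D(p−e_μ))`, the unit-lattice minus-Laplacian applied to a fine field
(`= Σ_r lapKer p r · D r`, `B5Hk103ScalarZd.tsum_lapKer_mul`). [folklore] -/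
def lapRow (D : X d → ℝ) (p : X d) : ℝ := ∑ μ, (2 * D p - D (p + e μ) - D (p - e μ))

/-- `Q'D = 0`: every block sum of `D` vanishes. [folklore] -/
def BlockMeanZero (n : ℕ) (D : X d → ℝ) : Prop := ∀ y'' : X d, ∑ r ∈ B n y'', D r = 0

/-- The weak Euler–Lagrange equation `⟨Δ^η A', D⟩ = 0` for every finitely supported (`supp A' ⊆ S`) test field with
`Q'A' = 0` — literally the identity certified for the columns of `H` by `B5Hk103ScalarZd.weakEL_kerH`
(print p. 29: «⟨∂A′, ∂H_kB⟩ = 0 on the subspace {A′ : Q_kA′ = 0, …}»; the definition only LOCATES the printed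
condition, scalar analogue). [cite: Balaban1984PropagatorsI, p.29 after (1.63)] -/
def WeakEL (n : ℕ) (D : X d → ℝ) : Prop :=
  ∀ (S : Finset (X d)) (A' : X d → ℝ), (∀ r ∉ S, A' r = 0) → (∀ y'' : X d, ∑ r ∈ B n y'', A' r = 0) →
    ∑' p, (∑ r ∈ S, ((n : ℝ) + 1) ^ 2 * lapKer p r * A' r) * D p = 0

/-! ## §2  `ℓ²` bookkeeping on `ℤ^d` [folklore] -/

/-- The product of two square-summable fields is summable (`|fg| ≤ (f² + g²)/2`). [folklore] -/
theorem summable_mul_of_sq {f g : X d → ℝ} (hf : Summable fun p => f p ^ 2) (hg : Summable fun p => g p ^ 2) :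
    Summable fun p => f p * g p := by
  refine Summable.of_norm_bounded ((hf.add hg).div_const 2) fun p => ?_
  rw [Real.norm_eq_abs, abs_mul]
  nlinarith [sq_nonneg (|f p| - |g p|), sq_abs (f p), sq_abs (g p), abs_nonneg (f p), abs_nonneg (g p)]

/-- Shift invariance of summability: `Σ_p F(p + v)` converges iff `Σ_p F(p)` does. [folklore] -/
theorem summable_addRight_iff {F : X d → ℝ} (v : X d) : (Summable fun p => F (p + v)) ↔ Summable F :=
  (Equiv.addRight v).summable_iff

/-- Shift invariance of sums: `Σ_p F(p + v) = Σ_p F(p)`. [folklore] -/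
theorem tsum_addRight {F : X d → ℝ} (v : X d) : ∑' p, F (p + v) = ∑' p, F p :=
  (Equiv.addRight v).tsum_eq F

/-- A square-summable field has square-summable shifts. [folklore] -/
theorem summable_sq_shift {D : X d → ℝ} (hD2 : Summable fun p => D p ^ 2) (v : X d) :
    Summable fun p => D (p + v) ^ 2 :=
  (summable_addRight_iff (F := fun p => D p ^ 2) v).2 hD2

/-- `Σ_p D(p − v)D(p) = Σ_p D(p)D(p + v)` (shift by `v`). [folklore] -/
theorem tsum_mul_subShift {D : X d → ℝ} (v : X d) : ∑' p, D (p - v) * D p = ∑' p, D p * D (p + v) := by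
  rw [← tsum_addRight (F := fun p => D (p - v) * D p) v]
  simp only [add_sub_cancel_right]

/-- A nonnegative summable block function pulled back to the fine lattice is summable:
`Σ_p G(blk p) = (n+1)^d Σ_y G(y)`. [folklore] -/
theorem summable_comp_blk (n : ℕ) {G : X d → ℝ} (hG : Summable G) (hG0 : ∀ y, 0 ≤ G y) :
    Summable fun p : X d => G (blk n p) := by
  refine summable_of_sum_le (fun p => hG0 _) (c := ((n : ℝ) + 1) ^ d * ∑' y, G y) fun s => ?_
  classical
  set T : Finset (X d) := s.image (blk n) with hT
  have hsub : s ⊆ T.biUnion (B n) := by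
    intro p hp
    rw [Finset.mem_biUnion]
    exact ⟨blk n p, Finset.mem_image_of_mem _ hp, mem_B.2 rfl⟩
  have hdisj : Set.PairwiseDisjoint (↑T : Set (X d)) (B n) := fun y _ y' _ hne => B_disjoint hne
  calc ∑ p ∈ s, G (blk n p) ≤ ∑ p ∈ T.biUnion (B n), G (blk n p) :=
        Finset.sum_le_sum_of_subset_of_nonneg hsub fun p _ _ => hG0 _
    _ = ∑ y ∈ T, ∑ p ∈ B n y, G (blk n p) := Finset.sum_biUnion hdisj
    _ = ∑ y ∈ T, ((n : ℝ) + 1) ^ d * G y := by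
        refine Finset.sum_congr rfl fun y _ => ?_
        rw [Finset.sum_congr rfl fun p hp => by rw [mem_B.1 hp], sum_B_const]
    _ = ((n : ℝ) + 1) ^ d * ∑ y ∈ T, G y := by rw [Finset.mul_sum]
    _ ≤ ((n : ℝ) + 1) ^ d * ∑' y, G y := by
        gcongr
        exact hG.sum_le_tsum T fun y _ => hG0 y

/-! ## §3  The Euler–Lagrange equation on two-point test fields: `ΔD` is constant on blocks [folklore] -/

/-- The row `p ↦ lapKer p r · D p`-type functions are finitely supported, hence summable. [folklore] -/
theorem summable_lapKer_mul (n : ℕ) (q : X d) (D : X d → ℝ) : Summable fun p => lapKer p q * D p := by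
  refine summable_of_ne_finset_zero (s := nbhd n q) fun p hp => ?_
  rw [lapKer_symm, lapKer_eq_zero_of_not_mem hp, zero_mul]

/-- `Σ_p lapKer p q · D p = (−ΔD)(q)`. [folklore] -/
theorem tsum_lapKer_mul' (q : X d) (D : X d → ℝ) : ∑' p, lapKer p q * D p = lapRow D q := by
  rw [show (fun p => lapKer p q * D p) = fun p => lapKer q p * D p from funext fun p => by rw [lapKer_symm]]
  exact tsum_lapKer_mul q D

/-- KEY STEP 1.  If `D` satisfies the weak Euler–Lagrange equation, then `ΔD` takes the same value at any two sites of
the same block (test field `A' = δ_p − δ_q`, which is finitely supported and block-mean-zero). [folklore] -/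
theorem lapRow_eq_of_blk_eq {n : ℕ} {D : X d → ℝ} (hEL : WeakEL n D) {p q : X d} (h : blk n p = blk n q) :
    lapRow D p = lapRow D q := by
  classical
  by_cases hpq : p = q
  · rw [hpq]
  set A' : X d → ℝ := fun r => (if r = p then 1 else 0) - (if r = q then 1 else 0) with hA'
  have hS : ∀ r ∉ ({p, q} : Finset (X d)), A' r = 0 := by
    intro r hr
    simp only [Finset.mem_insert, Finset.mem_singleton, not_or] at hr
    simp [hA', hr.1, hr.2]
  have hQ : ∀ y'' : X d, ∑ r ∈ B n y'', A' r = 0 := by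
    intro y''
    simp only [hA', Finset.sum_sub_distrib, Finset.sum_ite_eq', mem_B, h, sub_self]
  have hmain := hEL {p, q} A' hS hQ
  have hinner : ∀ t : X d, ∑ r ∈ ({p, q} : Finset (X d)), ((n : ℝ) + 1) ^ 2 * lapKer t r * A' r =
      ((n : ℝ) + 1) ^ 2 * (lapKer t p - lapKer t q) := by
    intro t
    have hp1 : A' p = 1 := by simp [hA', hpq]
    have hq1 : A' q = -1 := by simp [hA', Ne.symm hpq]
    rw [Finset.sum_insert (by simpa using hpq), Finset.sum_singleton, hp1, hq1]
    ring
  simp only [hinner] at hmain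
  have hsum : ∑' t, ((n : ℝ) + 1) ^ 2 * (lapKer t p - lapKer t q) * D t =
      ((n : ℝ) + 1) ^ 2 * (lapRow D p - lapRow D q) := by
    have h1 := summable_lapKer_mul n p D
    have h2 := summable_lapKer_mul n q D
    rw [← tsum_lapKer_mul' p D, ← tsum_lapKer_mul' q D, ← h1.tsum_sub h2, ← tsum_mul_left]
    refine tsum_congr fun t => ?_
    ring
  rw [hsum] at hmain
  have hc : ((n : ℝ) + 1) ^ 2 ≠ 0 := by positivity
  have := (mul_eq_zero.1 hmain).resolve_left hc
  linarith

/-! ## §4  `⟨ΔD, D⟩ = 0` from `Q'D = 0`, and the `ℓ²` summation by parts [folklore] -/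

/-- `p ↦ (ΔD)(p)·D(p)` is summable for square-summable `D`. [folklore] -/
theorem summable_lapRow_mul {D : X d → ℝ} (hD2 : Summable fun p => D p ^ 2) :
    Summable fun p => lapRow D p * D p := by
  have h0 : Summable fun p => D p * D p := by
    simpa [sq] using hD2
  have hplus : ∀ μ : Fin d, Summable fun p => D (p + e μ) * D p := fun μ =>
    summable_mul_of_sq (summable_sq_shift hD2 (e μ)) hD2
  have hminus : ∀ μ : Fin d, Summable fun p => D (p - e μ) * D p := fun μ => by
    simpa [sub_eq_add_neg] using summable_mul_of_sq (summable_sq_shift hD2 (-e μ)) hD2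
  have : (fun p => lapRow D p * D p) =
      fun p => ∑ μ : Fin d, (2 * (D p * D p) - D (p + e μ) * D p - D (p - e μ) * D p) := by
    funext p
    rw [lapRow, Finset.sum_mul]
    refine Finset.sum_congr rfl fun μ _ => ?_
    ring
  rw [this]
  exact summable_sum fun μ _ => ((h0.mul_left 2).sub (hplus μ)).sub (hminus μ)

/-- KEY STEP 2.  If `ΔD` is block-constant (weak Euler–Lagrange) and `Q'D = 0`, then `⟨ΔD, D⟩ = 0`: summing block
by block, `Σ_p (ΔD)(p)D(p) = Σ_y (ΔD)|_{B(y)} · Σ_{p∈B(y)} D(p) = 0`. [folklore] -/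
theorem tsum_lapRow_mul_eq_zero {n : ℕ} {D : X d → ℝ} (hD2 : Summable fun p => D p ^ 2)
    (hQ : BlockMeanZero n D) (hEL : WeakEL n D) : ∑' p, lapRow D p * D p = 0 := by
  set φ : X d → ℝ := fun y => lapRow D (chart n y fun _ => 0) with hφ
  have hconst : ∀ p, lapRow D p = φ (blk n p) := fun p =>
    lapRow_eq_of_blk_eq hEL (by rw [blk_chart])
  have hsum := summable_lapRow_mul hD2
  rw [← tsum_blocks n hsum]
  have hblock : ∀ y, ∑ q ∈ B n y, lapRow D q * D q = φ y * ∑ q ∈ B n y, D q := by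
    intro y
    rw [Finset.mul_sum]
    refine Finset.sum_congr rfl fun q hq => ?_
    rw [hconst q, mem_B.1 hq]
  have hQ' : ∀ y, ∑ q ∈ B n y, D q = 0 := hQ
  simp only [hblock, hQ', mul_zero, tsum_zero]

/-- KEY STEP 3 (`ℓ²` summation by parts on `ℤ^d`).  For square-summable `D`,
`⟨ΔD, D⟩ = Σ_μ Σ_p (D(p) − D(p + e_μ))²`. [folklore] -/
theorem tsum_lapRow_mul_self {D : X d → ℝ} (hD2 : Summable fun p => D p ^ 2) :
    ∑' p, lapRow D p * D p = ∑ μ : Fin d, ∑' p, (D p - D (p + e μ)) ^ 2 := by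
  have h0 : Summable fun p => D p * D p := by simpa [sq] using hD2
  have hplus : ∀ μ : Fin d, Summable fun p => D (p + e μ) * D p := fun μ =>
    summable_mul_of_sq (summable_sq_shift hD2 (e μ)) hD2
  have hplus' : ∀ μ : Fin d, Summable fun p => D p * D (p + e μ) := fun μ =>
    summable_mul_of_sq hD2 (summable_sq_shift hD2 (e μ))
  have hminus : ∀ μ : Fin d, Summable fun p => D (p - e μ) * D p := fun μ => by
    simpa [sub_eq_add_neg] using summable_mul_of_sq (summable_sq_shift hD2 (-e μ)) hD2
  have hsq : ∀ μ : Fin d, Summable fun p => D (p + e μ) * D (p + e μ) := fun μ => by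
    simpa [sq] using summable_sq_shift hD2 (e μ)
  -- both sides equal `Σ_μ (2 S₀ − 2 S₁(μ))`, `S₀ = Σ D², S₁(μ) = Σ D(p)D(p+e_μ)`
  have hL : ∀ μ : Fin d, ∑' p, (2 * (D p * D p) - D (p + e μ) * D p - D (p - e μ) * D p) =
      2 * ∑' p, D p * D p - 2 * ∑' p, D p * D (p + e μ) := by
    intro μ
    rw [((h0.mul_left 2).sub (hplus μ)).tsum_sub (hminus μ), (h0.mul_left 2).tsum_sub (hplus μ), tsum_mul_left,
      tsum_mul_subShift (e μ),
      show (fun p => D (p + e μ) * D p) = fun p => D p * D (p + e μ) from funext fun p => mul_comm _ _]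
    ring
  have hR : ∀ μ : Fin d, ∑' p, (D p - D (p + e μ)) ^ 2 = 2 * ∑' p, D p * D p - 2 * ∑' p, D p * D (p + e μ) := by
    intro μ
    have hexp : (fun p => (D p - D (p + e μ)) ^ 2) =
        fun p => (D p * D p - 2 * (D p * D (p + e μ))) + D (p + e μ) * D (p + e μ) := by
      funext p; ring
    rw [hexp, (h0.sub ((hplus' μ).mul_left 2)).tsum_add (hsq μ), h0.tsum_sub ((hplus' μ).mul_left 2),
      tsum_mul_left, tsum_addRight (F := fun p => D p * D p) (e μ)]
    ring
  have hsplit : (fun p => lapRow D p * D p) =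
      fun p => ∑ μ : Fin d, (2 * (D p * D p) - D (p + e μ) * D p - D (p - e μ) * D p) := by
    funext p
    rw [lapRow, Finset.sum_mul]
    refine Finset.sum_congr rfl fun μ _ => ?_
    ring
  rw [hsplit, Summable.tsum_finsetSum fun μ _ => ((h0.mul_left 2).sub (hplus μ)).sub (hminus μ)]
  exact Finset.sum_congr rfl fun μ _ => by rw [hL μ, hR μ]

/-! ## §5  The Liouville-type uniqueness theorem [folklore] -/

/-- KEY STEP 4.  Weak Euler–Lagrange + `Q'D = 0` + square-summability force invariance under every unit shift.
[folklore] -/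
theorem shift_eq_of_weakEL {n : ℕ} {D : X d → ℝ} (hD2 : Summable fun p => D p ^ 2) (hQ : BlockMeanZero n D)
    (hEL : WeakEL n D) (μ : Fin d) (p : X d) : D (p + e μ) = D p := by
  have hzero : ∑ ν : Fin d, ∑' q, (D q - D (q + e ν)) ^ 2 = 0 := by
    rw [← tsum_lapRow_mul_self hD2, tsum_lapRow_mul_eq_zero hD2 hQ hEL]
  have hsq : ∀ ν : Fin d, Summable fun q => (D q - D (q + e ν)) ^ 2 := by
    intro ν
    have hexp : (fun q => (D q - D (q + e ν)) ^ 2) =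
        fun q => (D q * D q - 2 * (D q * D (q + e ν))) + D (q + e ν) * D (q + e ν) := by
      funext q; ring
    rw [hexp]
    refine (Summable.sub (by simpa [sq] using hD2) ((summable_mul_of_sq hD2 (summable_sq_shift hD2 (e ν))).mul_left
      2)).add (by simpa [sq] using summable_sq_shift hD2 (e ν))
  have hμ : ∑' q, (D q - D (q + e μ)) ^ 2 = 0 :=
    (Finset.sum_eq_zero_iff_of_nonneg fun ν _ => tsum_nonneg fun q => sq_nonneg _).1 hzero μ (Finset.mem_univ μ)
  by_contra hne
  have hpos : 0 < (D p - D (p + e μ)) ^ 2 := by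
    have : D p - D (p + e μ) ≠ 0 := sub_ne_zero.2 (Ne.symm hne)
    positivity
  have := (hsq μ).tsum_pos (fun q => sq_nonneg _) p hpos
  linarith

/-- **Uniqueness (Liouville-type theorem for the constrained variational problem of [B5] p. 29, scalar, on `ℤ^d`).**
A square-summable fine field with vanishing block sums that satisfies the weak Euler–Lagrange equation is zero.
[folklore] -/
theorem eq_zero_of_weakEL {n : ℕ} {D : X d → ℝ} (hD2 : Summable fun p => D p ^ 2) (hQ : BlockMeanZero n D)
    (hEL : WeakEL n D) (p : X d) : D p = 0 := by
  rcases Nat.eq_zero_or_pos d with hd | hd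
  · -- `d = 0`: the lattice is a single site forming a single block, and `Q'D = 0` is `D = 0`.
    subst hd
    have hB := hQ (blk n p)
    rw [sum_B, Fintype.sum_unique] at hB
    have hc : ∀ z : Fin 0 → Fin (n + 1), chart n (blk n p) z = p := fun z => Subsingleton.elim _ _
    rwa [hc] at hB
  · -- `d ≥ 1`: `D` is constant along the injective orbit `k ↦ p + k•e_μ₀`, and square-summable fields tend to `0`.
    set μ₀ : Fin d := ⟨0, hd⟩
    set orb : ℕ → X d := fun k => p + (k : ℤ) • e μ₀ with horb
    have hconst : ∀ k : ℕ, D (orb k) = D p := by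
      intro k
      induction k with
      | zero => simp [horb]
      | succ k ih =>
        have : orb (k + 1) = orb k + e μ₀ := by
          simp only [horb]; push_cast; rw [add_smul, one_smul, add_assoc]
        rw [this, shift_eq_of_weakEL hD2 hQ hEL μ₀ (orb k), ih]
    have hinj : Function.Injective orb := by
      intro k₁ k₂ hk
      have := congr_fun hk μ₀
      simp only [horb, Pi.add_apply, Pi.smul_apply, e, Pi.single_eq_same, smul_eq_mul, mul_one,
        add_right_inj] at this
      exact_mod_cast this
    have ht : Tendsto (fun k => D (orb k) ^ 2) cofinite (𝓝 0) :=
      hD2.tendsto_cofinite_zero.comp hinj.tendsto_cofinite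
    simp only [hconst] at ht
    exact pow_eq_zero_iff (n := 2) (by norm_num) |>.1 (tendsto_const_nhds_iff.1 ht)

/-! ## §6  Uniqueness of `H` and its independence of `a` [folklore; print-located] -/

/-- `Q'D = 0` is preserved under differences. [folklore] -/
theorem blockMeanZero_sub {n : ℕ} {D₁ D₂ : X d → ℝ} (c : X d → ℝ) (h₁ : ∀ y'', ∑ r ∈ B n y'', D₁ r = c y'')
    (h₂ : ∀ y'', ∑ r ∈ B n y'', D₂ r = c y'') : BlockMeanZero n fun p => D₁ p - D₂ p := by
  intro y''
  rw [Finset.sum_sub_distrib, h₁, h₂, sub_self]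

/-- The test functional of the weak Euler–Lagrange equation is finitely supported in `p`. [folklore] -/
theorem summable_testRow_mul (n : ℕ) (S : Finset (X d)) (A' D : X d → ℝ) :
    Summable fun p => (∑ r ∈ S, ((n : ℝ) + 1) ^ 2 * lapKer p r * A' r) * D p := by
  classical
  refine summable_of_ne_finset_zero (s := S.biUnion fun r => nbhd n r) fun p hp => ?_
  rw [Finset.sum_eq_zero fun r hr => ?_, zero_mul]
  have hpr : p ∉ nbhd n r := fun h => hp (Finset.mem_biUnion.2 ⟨r, hr, h⟩)
  rw [lapKer_symm, lapKer_eq_zero_of_not_mem hpr, mul_zero, zero_mul]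

/-- The weak Euler–Lagrange equation is preserved under differences. [folklore] -/
theorem weakEL_sub {n : ℕ} {D₁ D₂ : X d → ℝ} (h₁ : WeakEL n D₁) (h₂ : WeakEL n D₂) :
    WeakEL n fun p => D₁ p - D₂ p := by
  intro S A' hS hQ
  simp only [mul_sub]
  rw [(summable_testRow_mul n S A' D₁).tsum_sub (summable_testRow_mul n S A' D₂), h₁ S A' hS hQ, h₂ S A' hS hQ,
    sub_self]

/-- The columns of `H` are square-summable (from the mesh-explicit pointwise decay `B5Hk103ScalarZd.abs_kerH_le`).
[folklore] -/
theorem summable_kerH_sq (n : ℕ) {a : ℝ} (ha : 0 < a) (y : X d) : Summable fun p => kerH n a p y ^ 2 := by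
  set M : ℝ := cH d a * Real.sqrt (((n : ℝ) + 1) ^ d) with hM
  set G : X d → ℝ := fun y'' => M ^ 2 * Real.exp (-(2 * deltaH d a * dist y y'')) with hG
  have hG0 : ∀ y'', 0 ≤ G y'' := fun y'' => by positivity
  have hGs : Summable G := (summable_expX (by have := deltaH_pos d ha; positivity) y).mul_left (M ^ 2)
  refine Summable.of_norm_bounded (summable_comp_blk n hGs hG0) fun p => ?_
  rw [Real.norm_eq_abs, abs_of_nonneg (sq_nonneg _), hG]
  have hb := abs_kerH_le n ha p y
  have hM0 : 0 ≤ M * Real.exp (-(deltaH d a * dist (blk n p) y)) := by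
    have := (cH_pos d ha).le; positivity
  calc kerH n a p y ^ 2 = |kerH n a p y| ^ 2 := (sq_abs _).symm
    _ ≤ (M * Real.exp (-(deltaH d a * dist (blk n p) y))) ^ 2 := pow_le_pow_left₀ (abs_nonneg _) hb 2
    _ = M ^ 2 * Real.exp (-(2 * deltaH d a * dist y (blk n p))) := by
        rw [mul_pow, sq (Real.exp _), ← Real.exp_add, dist_comm]
        ring_nf

/-- `Q'H = I` in block-sum form: `Σ_{p∈B(y'')} H(p,y) = (n+1)^d δ_{y''y}` (`B5Hk103ScalarZd.blockAvg_kerH`).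
(print p. 29: «Q_kH_kB = B»; proved outright). [cite: Balaban1984PropagatorsI, p.29 after (1.63)] -/
theorem sum_B_kerH (n : ℕ) {a : ℝ} (ha : 0 < a) (y'' y : X d) :
    ∑ p ∈ B n y'', kerH n a p y = ((n : ℝ) + 1) ^ d * (if y'' = y then 1 else 0) := by
  have h := blockAvg_kerH n ha y'' y
  have hne : ((n : ℝ) + 1) ^ d ≠ 0 := by positivity
  rwa [inv_mul_eq_iff_eq_mul₀ hne] at h

/-- The columns of `H` satisfy the weak Euler–Lagrange equation (`B5Hk103ScalarZd.weakEL_kerH`;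
proved outright). [cite: Balaban1984PropagatorsI, p.29 after (1.63)] -/
theorem weakEL_kerH_col (n : ℕ) {a : ℝ} (ha : 0 < a) (y : X d) : WeakEL n fun p => kerH n a p y :=
  fun S A' hS hQ => weakEL_kerH n ha S A' hS hQ y

/-- **Uniqueness of `H` (scalar, whole lattice `ℤ^d`).**  Any kernel with square-summable columns satisfying
`Q'K = I` and the weak Euler–Lagrange equation column by column IS `H = G'Q'*(Q'G'Q'*)⁻¹` — for every auxiliary
`a > 0`.  The theorem itself is ours (scalar analogue of the uniqueness implicit in p. 29 / (1.103) p. 34), proved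
outright. [cite: Balaban1984PropagatorsI, p.29 after (1.63)] -/
theorem kerH_unique (n : ℕ) {a : ℝ} (ha : 0 < a) (K : X d → X d → ℝ)
    (hK2 : ∀ y, Summable fun p => K p y ^ 2)
    (hKQ : ∀ y'' y, ∑ p ∈ B n y'', K p y = ((n : ℝ) + 1) ^ d * (if y'' = y then 1 else 0))
    (hKEL : ∀ y, WeakEL n fun p => K p y) : K = kerH n a := by
  funext p y
  have hD2 : Summable fun q => (K q y - kerH n a q y) ^ 2 := by
    refine Summable.of_norm_bounded (((hK2 y).mul_left 2).add ((summable_kerH_sq n ha y).mul_left 2)) fun q => ?_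
    rw [Real.norm_eq_abs, abs_of_nonneg (sq_nonneg _)]
    nlinarith [sq_nonneg (K q y + kerH n a q y)]
  have h := eq_zero_of_weakEL hD2
    (blockMeanZero_sub (fun y'' => ((n : ℝ) + 1) ^ d * (if y'' = y then 1 else 0)) (fun y'' => hKQ y'' y)
      (fun y'' => sum_B_kerH n ha y'' y))
    (weakEL_sub (hKEL y) (weakEL_kerH_col n ha y)) p
  linarith

/-- **`a`-independence of `H` (scalar, whole lattice `ℤ^d`):** `G'_aQ'*(Q'G'_aQ'*)⁻¹ = G'_{a'}Q'*(Q'G'_{a'}Q'*)⁻¹`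
for all `a, a' > 0` — the kernel counterpart of the print's `a`-free variational characterisation of `H_k` (p. 29)
versus its representation (1.103) through the auxiliary, `a`-dependent operator `G`; proved outright.
[cite: Balaban1984PropagatorsI, (1.103) p.34] -/
theorem kerH_eq_kerH (n : ℕ) {a a' : ℝ} (ha : 0 < a) (ha' : 0 < a') :
    kerH (d := d) n a = kerH n a' :=
  (kerH_unique (d := d) n ha (kerH n a') (summable_kerH_sq n ha') (fun y'' y => sum_B_kerH n ha' y'' y)
    (weakEL_kerH_col n ha')).symm

/-- Uniqueness in column form: a single square-summable column solving `Q'k = δ_y` and the weak Euler–Lagrange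
equation is the `y`-column of `H`. [folklore] -/
theorem col_eq_kerH (n : ℕ) {a : ℝ} (ha : 0 < a) (y : X d) (k : X d → ℝ) (hk2 : Summable fun p => k p ^ 2)
    (hkQ : ∀ y'', ∑ p ∈ B n y'', k p = ((n : ℝ) + 1) ^ d * (if y'' = y then 1 else 0)) (hkEL : WeakEL n k)
    (p : X d) : k p = kerH n a p y := by
  have hD2 : Summable fun q => (k q - kerH n a q y) ^ 2 := by
    refine Summable.of_norm_bounded ((hk2.mul_left 2).add ((summable_kerH_sq n ha y).mul_left 2)) fun q => ?_
    rw [Real.norm_eq_abs, abs_of_nonneg (sq_nonneg _)]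
    nlinarith [sq_nonneg (k q + kerH n a q y)]
  have h := eq_zero_of_weakEL hD2
    (blockMeanZero_sub (fun y'' => ((n : ℝ) + 1) ^ d * (if y'' = y then 1 else 0)) hkQ
      (fun y'' => sum_B_kerH n ha y'' y))
    (weakEL_sub hkEL (weakEL_kerH_col n ha y)) p
  linarith

/-! ## §7  Sanity [folklore] -/

/-- The zero field is the unique square-summable block-mean-zero weak solution (consistency instance of
`eq_zero_of_weakEL`). -/
example (n : ℕ) : WeakEL (d := d) n fun _ => 0 := by
  intro S A' hS hQ
  simp

example (n : ℕ) {a : ℝ} (ha : 0 < a) : kerH (d := d) n a = kerH n 1 := kerH_eq_kerH n ha one_pos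

end

end Literature.MathematicalPhysics.QuantumFieldTheory.Balaban1983to89.B5Hk103Unique
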